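import Literature.MeasureTheory.Integral.AnalyticSubmersionSharpDensity
import Literature.Analysis.Calculus.RealAnalyticZeroSetAddHaar

/-!
# ANALYTIC SUBMERSION + FIBREWISE-ANALYTIC THRESHOLDS, WITHOUT TRANSVERSALITY ⇒ the push-forward of a density continuous off the NON-FIBRE-FLAT
# part of the threshold sets still has a CONTINUOUS density (locally) — the flat-locus edition of `AnalyticSubmersionSharpDensity(Finite)`

Generic calculus ∕ measure theory on finite-dimensional real spaces; every declaration is a THEOREM proved here from Mathlib and the sibling
files of this directory (no `def`, no named fact, no `sorry`).  LOCATED CONSUMER (cell `pub-ymgap`, YM-PLAN Track A, node N09 [B12], width seat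
`pub-ymgap-dag-n09-w3` g5, `--supports` K1⁹ `StabilityBRunRowsAtRecordR13SepCoPHV` = stmt-QuantumFields-27364, count-neutral helper; this seat's bus line
LOCATED-1 I.35957): the sibling engines `exists_continuousOn_density_map_of_analytic_submersion_sharp` (p613264, dag-n09-w2 g3) and `…_sharp_finite`
(p623305, dag-n09-w2 g4) ask, per threshold `g_i`, (α) real-analyticity of `g_i` in the AMBIENT variable and (β) TRANSVERSALITY `∃ v ∈ ker DM(a),
Dg_i(a) v ≠ 0`.  For the (2.9) cut-off of [Balaban1987RG1] both are problematic: (α) the threshold `‖V^{(j)}(Ū)(b)⁻¹·U(b) − 1‖ = ε₁` contains the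
minimiser of the COARSE variable, analytic only by [B11] (N07) — yet ALONG EACH FIBRE `Ū = V₀` it is a polynomial functional of `U(b)`; (β) at a
configuration where two eigenvalues of the unitary `W = V^{(j)}(V₀)(b)⁻¹U(b)` sit on the sphere `|λ − 1| = ε₁` the differential of every analytic
defining function of the tree (`det((ε₁²−2)·1+W+Wᴴ)`, `det(λ·1−W)`) VANISHES (rank drop two), and on SU(2) this happens at EVERY threshold point
(`det((ε₁²−2)·1+W+Wᴴ) = (ε₁²−2+tr W)²`).  THIS FILE removes both: the thresholds are FIBREWISE (`g_i x = Γ_i (M x) x` with `Γ_i(y,·)` real-analytic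
on a fixed neighbourhood — no analyticity in the coarse variable), and transversality is replaced by NOTHING: the identity theorem enters through the
FLAT-LOCUS DICHOTOMY (`addHaar_zeroSet_diff_flat_eq_zero`: a.e. point of the zero set of a real-analytic function is a point where it vanishes
identically nearby), applied on each fibre; the price is that the exemption predicate becomes «`Γ_i(M x, x) ≠ 0` OR `Γ_i(M x, ·)` VANISHES NEAR `x`
ALONG THE FIBRE `M⁻¹(M x)`» — at fibre-flat threshold points the density must still be continuous.  Under the side condition «no threshold is
fibre-flat at any of its zeros» (implied by transversality; at the record implied by the open projection of the averaging fibres onto each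
non-central bond variable) the exemption is the siblings' plain `∀ i, g_i x ≠ 0` (§3).

WHAT IS PROVED (namespace `Literature.MeasureTheory.Integral.AnalyticSubmersion`, the siblings').
* §1 ★ `addHaar_zeroSet_diff_flat_eq_zero` — `K` finite-dimensional real normed, `μ` additive Haar, `h` real-analytic on an OPEN `V` (no connectedness):
  `μ {B ∈ V | h B = 0 ∧ ¬(∀ᶠ B' in 𝓝 B, h B' = 0)} = 0` ([Mityagin2015] on small balls + `measure_null_of_locally_null`).
* §2 ★★★ **`exists_continuousOn_density_map_of_analytic_submersion_sharp_fibreFlat`** — `E`, `Y` finite-dimensional real normed Borel spaces with additive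
  Haar measures `μE`, `μY`; `M : E → Y` measurable, `AnalyticAt ℝ M a`, `(fderiv ℝ M a).range = ⊤`; a COUNTABLE family `Γ : ι → Y → E → ℝ` with every
  `Γ i y` real-analytic on a fixed open `O₀ ∋ a`.  Then ∃ open `O ∋ a`, `O ⊆ O₀`, and `D ∋ M a` such that for every `r : E → ℝ` measurable, `0 ≤ r`, bounded
  on `O`, zero off `O`, and continuous at every `x ∈ O` satisfying `∀ i, Γ i (M x) x ≠ 0 ∨ ∀ᶠ x' in 𝓝[M ⁻¹' {M x}] x, Γ i (M x) x' = 0`: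
  ∃ `I : Y → ℝ`, `0 ≤ I`, `ContinuousOn I D`, `(r·μE)(M⁻¹A) = ∫⁻_A I dμY` for every Borel `A ⊆ D`.  NO transversality hypothesis.
* §3 ★★ `exists_continuousOn_density_map_of_analytic_submersion_sharp_of_nowhereFibreFlat` — the same with the plain exemption `∀ i, Γ i (M x) x ≠ 0`
  under «NOWHERE FIBRE-FLAT on `O₀`»: `∀ x ∈ O₀, ∀ i, Γ i (M x) x = 0 → ∃ᶠ x' in 𝓝[M ⁻¹' {M x}] x, Γ i (M x) x' ≠ 0`;
  ★ `exists_continuousOn_density_map_of_analytic_submersion_sharp_ambient_fibreFlat` — ambient thresholds `g i : E → ℝ` analytic on `O₀` (`Γ i y := g i`),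
  exemption «`g i x ≠ 0` or `g i` fibre-flat at `x`», no transversality (p613264 ∕ p623305's setting minus (β)).

HONEST SCOPE.  (i) Local, near one point; `r` must vanish off the chart neighbourhood `O`.  (ii) The fibre-flat alternative in the exemption is GENUINELY
needed without a side condition: if a threshold vanishes on a whole fibre piece the density may jump across that fibre (`M(x,y) = y`, `Γ ≡ y`).  (iii) Nothing
model-specific (the analytic-submersion property of the chart-read (0.4) averaging, the fibrewise polynomiality of the (2.9) thresholds, the open bond
projection of the fibres are the consumer's inputs); no claim about Bałaban's renormalization group, N09 or the Clay problem.  (iv) Nothing of p613264 ∕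
p623305 ∕ p611693 ∕ p610570 is re-proved: the implicit-function chart bookkeeping is p613264's verbatim, the fibre-integral engine
`FibreCoordinates.continuousOn_density_of_fibreCoordinates_of_ae` and the Haar transport `SubmersionPushforward.exists_haarFactor_lintegral_comp_equiv` are BY NAME.
-/

noncomputable section

namespace Literature.MeasureTheory.Integral.AnalyticSubmersion

open _root_.MeasureTheory _root_.MeasureTheory.Measure Set Function Filter Metric
open scoped ENNReal NNReal Topology

/-! ## §1 The flat-locus dichotomy on a finite-dimensional real space (no connectedness) -/

section FlatLocus

variable {K : Type*} [NormedAddCommGroup K] [NormedSpace ℝ K] [FiniteDimensional ℝ K] [MeasurableSpace K] [BorelSpace K]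

/-- ★ **THE FLAT-LOCUS DICHOTOMY** ([Mityagin2015] localised): for `h` real-analytic on an OPEN set `V` of a finite-dimensional real normed space and
any additive Haar measure `μ`, the zero set of `h` in `V` is `μ`-null UP TO ITS FLAT LOCUS `{B | h ≡ 0 near B}` — no connectedness of `V`, no
non-vanishing witness (on each small ball either `h ≡ 0`, and the ball is flat, or Prop. 1 applies). [cite: Mityagin2015, Proposition 1] -/
theorem addHaar_zeroSet_diff_flat_eq_zero (μ : Measure K) [μ.IsAddHaarMeasure] {V : Set K} (hV : IsOpen V) {h : K → ℝ}
    (hh : AnalyticOnNhd ℝ h V) :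
    μ {B | B ∈ V ∧ h B = 0 ∧ ¬ (∀ᶠ B' in 𝓝 B, h B' = 0)} = 0 := by
  refine measure_null_of_locally_null _ fun B hB => ?_
  obtain ⟨hBV, _, hnf⟩ := hB
  obtain ⟨δ, hδ, hball⟩ := Metric.isOpen_iff.1 hV B hBV
  by_cases hall : ∀ B' ∈ ball B δ, h B' = 0
  · exact absurd (Filter.mem_of_superset (ball_mem_nhds B hδ) fun B' hB' => hall B' hB') hnf
  · push Not at hall
    obtain ⟨B₀, hB₀, hB₀ne⟩ := hall
    refine ⟨{B | B ∈ V ∧ h B = 0 ∧ ¬ (∀ᶠ B' in 𝓝 B, h B' = 0)} ∩ ball B δ,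
      inter_mem_nhdsWithin _ (ball_mem_nhds B hδ), ?_⟩
    have hnull : μ {B' ∈ ball B δ | h B' = 0} = 0 :=
      Literature.Analysis.Calculus.addHaar_zeroSet_eq_zero_of_analyticOnNhd μ isOpen_ball
        ((convex_ball B δ).isConnected ⟨B, mem_ball_self hδ⟩) (hh.mono hball) ⟨B₀, hB₀, hB₀ne⟩
    refine measure_mono_null (fun B' hB' => ?_) hnull
    exact ⟨hB'.2, hB'.1.2.1⟩

end FlatLocus

/-! ## §2 The flat-locus sharp engine: fibrewise-analytic thresholds, no transversality -/

variable {E Y : Type*}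
  [NormedAddCommGroup E] [NormedSpace ℝ E] [FiniteDimensional ℝ E] [MeasurableSpace E] [BorelSpace E]
  [NormedAddCommGroup Y] [NormedSpace ℝ Y] [FiniteDimensional ℝ Y] [MeasurableSpace Y] [BorelSpace Y]

/-- ★★★ **ANALYTIC SUBMERSION + FIBREWISE-ANALYTIC THRESHOLDS ⇒ CONTINUOUS PUSH-FORWARD DENSITY FOR DENSITIES CONTINUOUS OFF THE NON-FIBRE-FLAT PART OF
THE THRESHOLD SETS — NO TRANSVERSALITY.**  See the module docstring.  (p613264's implicit-function fibre coordinates, analytic by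
`OpenPartialHomeomorph.analyticAt_symm`; on each fibre window the FLAT-LOCUS dichotomy `addHaar_zeroSet_diff_flat_eq_zero` for every fibre section
`B ↦ Γ_i(W₀, φ⁻¹(W₀,B))`, countable union; a fibre-flat point of the section is a point where `Γ_i(W₀,·)` vanishes near `φ⁻¹(W₀,B)` ALONG THE FIBRE, so the
exemption clause applies; `FibreCoordinates.continuousOn_density_of_fibreCoordinates_of_ae`; Haar transport.)
[cite: EvansGariepy1992, §3.4.2 Thm 1 and §3.4.3 Thm 2 (C¹-submersion special case)] [cite: Mityagin2015, Proposition 1]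
[cite: Balaban1987RG1, (2.9)–(2.10) pp.266–267 (measure-level reading)] -/
theorem exists_continuousOn_density_map_of_analytic_submersion_sharp_fibreFlat {ι : Type*} [Countable ι] (μE : Measure E)
    [μE.IsAddHaarMeasure] (μY : Measure Y) [μY.IsAddHaarMeasure] {M : E → Y} (hMm : Measurable M) {a : E} (hMan : AnalyticAt ℝ M a)
    (hsurj : (fderiv ℝ M a).range = ⊤) {Γ : ι → Y → E → ℝ} {O₀ : Set E} (hO₀ : IsOpen O₀) (haO₀ : a ∈ O₀)
    (hΓan : ∀ i y, AnalyticOnNhd ℝ (Γ i y) O₀) :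
    ∃ O : Set E, IsOpen O ∧ a ∈ O ∧ O ⊆ O₀ ∧ ∃ D : Set Y, IsOpen D ∧ M a ∈ D ∧
      ∀ r : E → ℝ, Measurable r → (∀ x, 0 ≤ r x) →
        (∀ x ∈ O, (∀ i, Γ i (M x) x ≠ 0 ∨ ∀ᶠ x' in 𝓝[M ⁻¹' {M x}] x, Γ i (M x) x' = 0) → ContinuousAt r x) →
        (∃ C, ∀ x ∈ O, r x ≤ C) → (∀ x, x ∉ O → r x = 0) →
        ∃ I : Y → ℝ, ContinuousOn I D ∧ (∀ W, 0 ≤ I W) ∧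
          ∀ A : Set Y, MeasurableSet A → A ⊆ D →
            (μE.withDensity fun x => ENNReal.ofReal (r x)) (M ⁻¹' A) = ∫⁻ W in A, ENNReal.ofReal (I W) ∂μY := by
  classical
  haveI : CompleteSpace E := FiniteDimensional.complete ℝ E
  haveI : CompleteSpace Y := FiniteDimensional.complete ℝ Y
  have hM : ContDiffAt ℝ 1 M a := hMan.contDiffAt.of_le le_top
  -- the differential and the implicit-function chart `φ = (M, π(· − a))` (p613264 verbatim)
  set f' : E →L[ℝ] Y := fderiv ℝ M a with hf'def
  have hf : HasStrictFDerivAt M f' a := hM.hasStrictFDerivAt one_ne_zero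
  have hker : f'.ker.ClosedComplemented := f'.ker_closedComplemented_of_finiteDimensional_range
  haveI : CompleteSpace f'.ker := FiniteDimensional.complete ℝ f'.ker
  letI : MeasurableSpace f'.ker := borel f'.ker
  haveI : BorelSpace f'.ker := ⟨rfl⟩
  set π : E →L[ℝ] f'.ker := Classical.choose hker with hπ
  set 𝒟 : ImplicitFunctionData ℝ E Y f'.ker := HasStrictFDerivAt.implicitFunctionDataOfComplemented M f' hf hsurj hker
    with h𝒟
  set φ := 𝒟.toOpenPartialHomeomorph with hφ
  have hφ1 : ∀ x, (φ x).1 = M x := fun x => rfl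
  have hφapp : ∀ x, φ x = (M x, π (x - a)) := fun x => rfl
  have ha : a ∈ φ.source := 𝒟.pt_mem_toOpenPartialHomeomorph_source
  have hφa : φ a = (M a, 0) := by rw [hφapp]; simp
  set e₀ : E ≃L[ℝ] Y × f'.ker := f'.equivProdOfSurjectiveOfIsCompl π hsurj
    (LinearMap.range_eq_of_proj (Classical.choose_spec hker)) (LinearMap.isCompl_of_proj (Classical.choose_spec hker)) with he₀
  have hφder : HasStrictFDerivAt φ (e₀ : E →L[ℝ] Y × f'.ker) a := 𝒟.hasStrictFDerivAt
  -- `φ` is analytic near `a` with invertible derivative; the window is cut down to `O₀`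
  have hπan : ∀ x, AnalyticAt ℝ (fun x => π (x - a)) x := fun x => (π.analyticAt _).comp (analyticAt_id.sub analyticAt_const)
  have hφanA : ∀ᶠ x in 𝓝 a, AnalyticAt ℝ φ x := by
    filter_upwards [hMan.eventually_analyticAt] with x hx
    exact hx.prod (hπan x)
  have hφC1 : ContDiffAt ℝ 1 φ a := (hMan.prod (hπan a)).contDiffAt.of_le le_top
  have hinvA : ∀ᶠ x in 𝓝 a, (fderiv ℝ φ x).IsInvertible := by
    have hcont : ContinuousAt (fderiv ℝ φ) a := hφC1.continuousAt_fderiv one_ne_zero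
    have hmem : fderiv ℝ φ a ∈ Set.range ((↑) : (E ≃L[ℝ] Y × f'.ker) → E →L[ℝ] Y × f'.ker) :=
      ⟨e₀, hφder.hasFDerivAt.fderiv.symm⟩
    filter_upwards [hcont.preimage_mem_nhds (ContinuousLinearEquiv.isOpen.mem_nhds hmem)] with x hx
    obtain ⟨e, he⟩ := hx
    exact ⟨e, he⟩
  obtain ⟨Nₐ, hNₐsub, hNₐo, haNₐ⟩ : ∃ Nₐ : Set E, Nₐ ⊆ {x | AnalyticAt ℝ φ x ∧ (fderiv ℝ φ x).IsInvertible ∧ x ∈ O₀} ∧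
      IsOpen Nₐ ∧ a ∈ Nₐ := by
    obtain ⟨N, hN, hNo, hmem⟩ := _root_.eventually_nhds_iff.1 ((hφanA.and hinvA).and (hO₀.mem_nhds haO₀))
    exact ⟨N, fun x hx => ⟨(hN x hx).1.1, (hN x hx).1.2, (hN x hx).2⟩, hNo, hmem⟩
  -- the window `W` in the target: `φ.symm` analytic (hence C¹) there, with values in `Nₐ ⊆ O₀`
  set W : Set (Y × f'.ker) := φ.target ∩ φ.symm ⁻¹' Nₐ with hW'
  have hWo : IsOpen W := by
    have h := φ.symm.isOpen_inter_preimage hNₐo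
    rwa [φ.symm_source] at h
  have haW : φ a ∈ W := ⟨φ.map_source ha, by show φ.symm (φ a) ∈ Nₐ; rw [φ.left_inv ha]; exact haNₐ⟩
  have hWt : W ⊆ φ.target := fun p hp => hp.1
  have hsymN : ∀ p ∈ W, φ.symm p ∈ Nₐ := fun p hp => hp.2
  have hanOn : ∀ p ∈ W, AnalyticAt ℝ φ.symm p := by
    intro p hp
    obtain ⟨e, he⟩ := (hNₐsub (hsymN p hp)).2.1
    exact φ.analyticAt_symm (hWt hp) (hNₐsub (hsymN p hp)).1 he.symm
  have hsymO₀ : ∀ p ∈ W, φ.symm p ∈ O₀ := fun p hp => (hNₐsub (hsymN p hp)).2.2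
  have hsmOn : ContDiffOn ℝ 1 φ.symm W := fun p hp => ((hanOn p hp).contDiffAt.of_le le_top).contDiffWithinAt
  have hdiff : ∀ p ∈ W, HasFDerivAt φ.symm (fderiv ℝ φ.symm p) p := fun p hp => ((hanOn p hp).differentiableAt).hasFDerivAt
  have hcontD : ContinuousOn (fderiv ℝ φ.symm) W := hsmOn.continuousOn_fderiv_of_isOpen hWo le_rfl
  -- the coarse variable of `φ.symm p` is `p.1`
  have hMsymm : ∀ p ∈ φ.target, M (φ.symm p) = p.1 := fun p hp => by rw [← hφ1, φ.right_inv hp]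
  -- a linear identification `L : E ≃L Y × ker f'`
  have hrank : Module.finrank ℝ E = Module.finrank ℝ (Y × f'.ker) := by
    have h1 := LinearMap.finrank_range_add_finrank_ker (f' : E →ₗ[ℝ] Y)
    have h2 : Module.finrank ℝ (LinearMap.range (f' : E →ₗ[ℝ] Y)) = Module.finrank ℝ Y := by
      rw [show LinearMap.range (f' : E →ₗ[ℝ] Y) = ⊤ from hsurj, finrank_top]
    rw [Module.finrank_prod, ← h1, h2]
  set L : E ≃L[ℝ] Y × f'.ker := ContinuousLinearEquiv.ofFinrankEq hrank with hL
  -- radii: a compact ball inside `W`, and the product window of half the radius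
  obtain ⟨ε, hε, hεW⟩ : ∃ ε > 0, closedBall (φ a) ε ⊆ W := nhds_basis_closedBall.mem_iff.1 (hWo.mem_nhds haW)
  set D : Set Y := ball (M a) (ε / 2) with hD
  set V : Set f'.ker := ball 0 (ε / 2) with hV
  set U : Set (Y × f'.ker) := D ×ˢ V with hU
  have hε2 : 0 < ε / 2 := by positivity
  have hUball : U = ball (φ a) (ε / 2) := by rw [hU, hD, hV, hφa, ball_prod_same]
  have hUW : U ⊆ W := by
    rw [hUball]; exact (ball_subset_closedBall.trans (closedBall_subset_closedBall (by linarith))).trans hεW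
  have hUt : U ⊆ φ.target := hUW.trans hWt
  have hUo : IsOpen U := by rw [hUball]; exact isOpen_ball
  have hUm : MeasurableSet U := hUo.measurableSet
  have hVo : IsOpen V := isOpen_ball
  -- bound for the Jacobian of `L ∘ φ.symm` on the compact ball
  have hJcont : ContinuousOn (fun p => ((L : E →L[ℝ] Y × f'.ker).comp (fderiv ℝ φ.symm p)).det) W :=
    ContinuousLinearMap.continuous_det.comp_continuousOn
      (((ContinuousLinearMap.compL ℝ (Y × f'.ker) E (Y × f'.ker)) (L : E →L[ℝ] Y × f'.ker)).continuous.comp_continuousOn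
        hcontD)
  obtain ⟨CJ, hCJ⟩ : ∃ CJ, ∀ p ∈ closedBall (φ a) ε,
      ‖((L : E →L[ℝ] Y × f'.ker).comp (fderiv ℝ φ.symm p)).det‖ ≤ CJ :=
    (isCompact_closedBall (φ a) ε).exists_bound_of_continuousOn (hJcont.mono hεW)
  -- the chart neighbourhood `O = φ.symm (U)`
  set O : Set E := φ.symm '' U with hO
  have hOo : IsOpen O := φ.isOpen_image_symm_of_subset_target hUo hUt
  have haO : a ∈ O := ⟨φ a, by rw [hUball]; exact mem_ball_self hε2, φ.left_inv ha⟩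
  have hOO₀ : O ⊆ O₀ := by rintro x ⟨p, hp, rfl⟩; exact hsymO₀ p (hUW hp)
  refine ⟨O, hOo, haO, hOO₀, D, isOpen_ball, mem_ball_self hε2, ?_⟩
  intro r hrm hr0 hrc hrb hrO
  obtain ⟨Cr, hCr⟩ := hrb
  -- the model objects on `Y × ker f'`
  set Ψ : Y × f'.ker → Y × f'.ker := U.piecewise (fun p => L (φ.symm p)) (fun _ => L a) with hΨ
  set Ψ' : Y × f'.ker → (Y × f'.ker →L[ℝ] Y × f'.ker) :=
    fun p => (L : E →L[ℝ] Y × f'.ker).comp (fderiv ℝ φ.symm p) with hΨ'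
  set M' : Y × f'.ker → Y := fun y => M (L.symm y) with hM'
  set r' : Y × f'.ker → ℝ := fun y => r (L.symm y) with hr'
  -- the fibre sections of the thresholds, read through the implicit chart
  set s : ι → Y → f'.ker → ℝ := fun i W₀ B => Γ i W₀ (φ.symm (W₀, B)) with hs
  have hΨU : ∀ p ∈ U, Ψ p = L (φ.symm p) := fun p hp => by rw [hΨ, piecewise_eq_of_mem _ _ _ hp]
  have hr'Ψ : ∀ p ∈ U, r' (Ψ p) = r (φ.symm p) := fun p hp => by
    show r (L.symm (Ψ p)) = r (φ.symm p); rw [hΨU p hp, L.symm_apply_apply]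
  -- hypotheses of the M4 engine (as in `SubmersionPushforwardDensity`)
  have hΨ'w : ∀ p ∈ U, HasFDerivWithinAt Ψ (Ψ' p) U p := by
    intro p hp
    have h : HasFDerivAt (fun q => L (φ.symm q)) (Ψ' p) p :=
      (L : E →L[ℝ] Y × f'.ker).hasFDerivAt.comp p (hdiff p (hUW hp))
    exact h.hasFDerivWithinAt.congr (fun q hq => hΨU q hq) (hΨU p hp)
  have hinj : InjOn Ψ U := by
    intro p hp q hq hpq
    rw [hΨU p hp, hΨU q hq] at hpq
    exact φ.symm.injOn (φ.symm_source.symm ▸ hUt hp) (φ.symm_source.symm ▸ hUt hq) (L.injective hpq)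
  have hΨm : Measurable Ψ := by
    refine ContinuousOn.measurable_piecewise ?_ continuousOn_const hUm
    exact L.continuous.comp_continuousOn (φ.continuousOn_symm.mono hUt)
  have hJm : Measurable fun p => (Ψ' p).det :=
    ContinuousLinearMap.continuous_det.measurable.comp
      (((ContinuousLinearMap.compL ℝ (Y × f'.ker) E (Y × f'.ker)) (L : E →L[ℝ] Y × f'.ker)).continuous.measurable.comp
        (measurable_fderiv ℝ φ.symm))
  have hM'm : Measurable M' := hMm.comp L.symm.continuous.measurable
  have hM'Ψ : ∀ p ∈ U, M' (Ψ p) = p.1 := by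
    intro p hp
    rw [hΨU p hp, hM']
    show M (L.symm (L (φ.symm p))) = p.1
    rw [L.symm_apply_apply]; exact hMsymm p (hUt hp)
  have hr'm : Measurable r' := hrm.comp L.symm.continuous.measurable
  have hr'0 : ∀ y, 0 ≤ r' y := fun y => hr0 _
  have hsupp : ∀ y, M' y ∈ D → y ∉ Ψ '' U → r' y = 0 := by
    intro y _ hy
    refine hrO _ fun ⟨p, hp, hpy⟩ => hy ⟨p, hp, by rw [hΨU p hp, hpy, L.apply_symm_apply]⟩
  have hCI : ∀ p ∈ D ×ˢ V, |(Ψ' p).det| * r' (Ψ p) ≤ max CJ 0 * max Cr 0 := by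
    intro p hp
    rw [← hU] at hp
    have hpb : p ∈ closedBall (φ a) ε := (ball_subset_closedBall.trans (closedBall_subset_closedBall (by linarith))) (hUball ▸ hp)
    have h1 : |(Ψ' p).det| ≤ max CJ 0 := le_trans (by simpa [Real.norm_eq_abs] using hCJ p hpb) (le_max_left _ _)
    have h2 : r' (Ψ p) ≤ max Cr 0 := by rw [hr'Ψ p hp]; exact (hCr _ ⟨p, hp, rfl⟩).trans (le_max_left _ _)
    exact mul_le_mul h1 h2 (hr'0 _) (le_max_of_le_right le_rfl)
  have hVm : MeasurableSet V := isOpen_ball.measurableSet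
  have hDm : MeasurableSet D := isOpen_ball.measurableSet
  have hVfin : (Measure.addHaar : Measure f'.ker) V ≠ ∞ := (measure_ball_lt_top).ne
  -- ★ the FIBRE (F2), flat-locus form: for each `W₀ ∈ D` the NON-flat zeros of the fibre sections have null trace on the fibre window
  set Zbad : Set (Y × f'.ker) :=
    {p | ∃ i, s i p.1 p.2 = 0 ∧ ¬ (∀ᶠ B' in 𝓝 p.2, s i p.1 B' = 0)} with hZbad
  have hfib : ∀ W₀ ∈ D, (Measure.addHaar : Measure f'.ker) {B | B ∈ V ∧ (W₀, B) ∈ Zbad} = 0 := by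
    intro W₀ hW₀
    have hmemU : ∀ B ∈ V, (W₀, B) ∈ U := fun B hB => by rw [hU]; exact ⟨hW₀, hB⟩
    -- analyticity of every fibre section on `V`
    have han : ∀ i, AnalyticOnNhd ℝ (s i W₀) V := by
      intro i B hB
      have hpW : (W₀, B) ∈ W := hUW (hmemU B hB)
      have hsφ : AnalyticAt ℝ (fun q : Y × f'.ker => Γ i W₀ (φ.symm q)) (W₀, B) :=
        (hΓan i W₀ _ (hsymO₀ _ hpW)).comp (hanOn _ hpW)
      exact hsφ.comp (analyticAt_const.prod analyticAt_id)
    have hsub : {B | B ∈ V ∧ (W₀, B) ∈ Zbad} ⊆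
        ⋃ i, {B | B ∈ V ∧ s i W₀ B = 0 ∧ ¬ (∀ᶠ B' in 𝓝 B, s i W₀ B' = 0)} := by
      rintro B ⟨hBV, i, hi⟩; exact mem_iUnion.2 ⟨i, hBV, hi⟩
    exact measure_mono_null hsub ((measure_iUnion_null_iff).2 fun i =>
      addHaar_zeroSet_diff_flat_eq_zero (Measure.addHaar : Measure f'.ker) hVo (han i))
  -- ★ a fibre-flat point of a section is a point where the threshold vanishes near it ALONG THE FIBRE
  have hflat : ∀ W₀ ∈ D, ∀ B ∈ V, ∀ i, (∀ᶠ B' in 𝓝 B, s i W₀ B' = 0) →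
      ∀ᶠ x' in 𝓝[M ⁻¹' {M (φ.symm (W₀, B))}] φ.symm (W₀, B), Γ i (M (φ.symm (W₀, B))) x' = 0 := by
    intro W₀ hW₀ B hB i hfl
    have hpU : (W₀, B) ∈ U := by rw [hU]; exact ⟨hW₀, hB⟩
    have hpt : (W₀, B) ∈ φ.target := hUt hpU
    have hx : φ.symm (W₀, B) ∈ φ.source := φ.map_target hpt
    have hMx : M (φ.symm (W₀, B)) = W₀ := hMsymm _ hpt
    rw [hMx]
    -- `x' ↦ (φ x').2` is continuous at `x` and equals `B` there
    have h2 : Tendsto (fun x' => (φ x').2) (𝓝 (φ.symm (W₀, B))) (𝓝 B) := by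
      have h := (continuous_snd.tendsto _).comp (φ.continuousAt hx)
      rwa [φ.right_inv hpt] at h
    have h3 : ∀ᶠ x' in 𝓝 (φ.symm (W₀, B)), s i W₀ ((φ x').2) = 0 := h2.eventually hfl
    have h4 : ∀ᶠ x' in 𝓝 (φ.symm (W₀, B)), x' ∈ φ.source := φ.open_source.mem_nhds hx
    have h5 : ∀ᶠ x' in 𝓝[M ⁻¹' {W₀}] φ.symm (W₀, B), x' ∈ M ⁻¹' {W₀} := eventually_mem_nhdsWithin
    filter_upwards [mem_nhdsWithin_of_mem_nhds (h3.and h4), h5] with x' hx' hx'M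
    obtain ⟨hs0, hsrc⟩ := hx'
    have hφx' : φ x' = (W₀, (φ x').2) := Prod.ext (by rw [hφ1]; exact hx'M) rfl
    rw [show x' = φ.symm (W₀, (φ x').2) by rw [← hφx', φ.left_inv hsrc]]
    exact hs0
  -- ★ fibrewise-a.e. continuity of the fibre integrand in the coarse variable
  have hcont : ∀ W₀ ∈ D, ∀ᵐ B ∂((Measure.addHaar : Measure f'.ker).restrict V),
      ContinuousWithinAt (fun W => |(Ψ' (W, B)).det| * r' (Ψ (W, B))) D W₀ := by
    intro W₀ hW₀
    refine FibreCoordinates.ae_continuousWithinAt_of_null_fibreSet (Measure.addHaar : Measure f'.ker) hVm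
      (G := fun p => |(Ψ' p).det| * r' (Ψ p)) (D := D) (Z := Zbad) (hfib W₀ hW₀) (fun B hB hBZ => ?_)
    have hmemU : ∀ W ∈ D, (W, B) ∈ U := fun W hW => by rw [hU]; exact ⟨hW, hB⟩
    have hpU : (W₀, B) ∈ U := hmemU W₀ hW₀
    have hpt : (W₀, B) ∈ φ.target := hUt hpU
    -- the Jacobian factor is continuous in `W`
    have hJ : ContinuousWithinAt (fun W => |(Ψ' (W, B)).det|) D W₀ :=
      ((continuous_abs.comp_continuousOn (hJcont.mono hUW)).comp (Continuous.prodMk_left B).continuousOn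
        (fun W hW => hmemU W hW)).continuousWithinAt hW₀
    -- the density factor: `r` continuous at `φ.symm (W₀, B)` by the exemption clause (non-zero OR fibre-flat), `φ.symm` continuous
    have hx₀ : ∀ i, Γ i (M (φ.symm (W₀, B))) (φ.symm (W₀, B)) ≠ 0 ∨
        ∀ᶠ x' in 𝓝[M ⁻¹' {M (φ.symm (W₀, B))}] φ.symm (W₀, B), Γ i (M (φ.symm (W₀, B))) x' = 0 := by
      intro i
      by_cases hsi : s i W₀ B = 0
      · right
        have hfl : ∀ᶠ B' in 𝓝 B, s i W₀ B' = 0 := by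
          by_contra hnf
          exact hBZ ⟨i, hsi, hnf⟩
        exact hflat W₀ hW₀ B hB i hfl
      · left
        rw [hMsymm _ hpt]
        exact hsi
    have hrcont : ContinuousAt r (φ.symm (W₀, B)) := hrc _ ⟨(W₀, B), hpU, rfl⟩ hx₀
    have hsymc : ContinuousWithinAt (fun W => φ.symm (W, B)) D W₀ :=
      ((φ.continuousOn_symm.mono hUt).comp (Continuous.prodMk_left B).continuousOn (fun W hW => hmemU W hW))
        |>.continuousWithinAt hW₀
    have hR : ContinuousWithinAt (fun W => r (φ.symm (W, B))) D W₀ :=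
      ContinuousAt.comp_continuousWithinAt (f := fun W => φ.symm (W, B)) (x := W₀) hrcont hsymc
    refine (hJ.mul hR).congr (fun W hW => ?_) ?_
    · show |(Ψ' (W, B)).det| * r' (Ψ (W, B)) = |(Ψ' (W, B)).det| * r (φ.symm (W, B))
      rw [hr'Ψ _ (hmemU W hW)]
    · show |(Ψ' (W₀, B)).det| * r' (Ψ (W₀, B)) = |(Ψ' (W₀, B)).det| * r (φ.symm (W₀, B))
      rw [hr'Ψ _ hpU]
  -- the M4 engine, sharp form, in the model `Y × ker f'` (p611693 BY NAME)
  obtain ⟨hIcont, hIdens⟩ := FibreCoordinates.continuousOn_density_of_fibreCoordinates_of_ae μY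
    (Measure.addHaar : Measure f'.ker) hDm hVm hVfin hU hΨ'w hinj hΨm hJm hM'm hM'Ψ hr'm hr'0 hsupp hcont hCI
  -- transport back to `E` along `L` (p610570 BY NAME)
  obtain ⟨c, hc, hcid⟩ := SubmersionPushforward.exists_haarFactor_lintegral_comp_equiv μE μY
    (Measure.addHaar : Measure f'.ker) L
  set I₀ : Y → ℝ := fun W => ∫ B in V, |(Ψ' (W, B)).det| * r' (Ψ (W, B)) ∂(Measure.addHaar : Measure f'.ker) with hI₀
  have hI₀0 : ∀ W, 0 ≤ I₀ W := fun W => setIntegral_nonneg hVm fun B _ => mul_nonneg (abs_nonneg _) (hr'0 _)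
  refine ⟨fun W => (c : ℝ) * I₀ W, (continuousOn_const.mul hIcont), fun W => mul_nonneg c.coe_nonneg (hI₀0 W), ?_⟩
  intro A hA hAD
  have hpre : M ⁻¹' A = L ⁻¹' (M' ⁻¹' A) := by
    ext x
    simp only [mem_preimage, hM', L.symm_apply_apply]
  calc (μE.withDensity fun x => ENNReal.ofReal (r x)) (M ⁻¹' A)
      = ∫⁻ x, (M ⁻¹' A).indicator (fun x => ENNReal.ofReal (r x)) x ∂μE := by
        rw [withDensity_apply _ (hMm hA), lintegral_indicator (hMm hA)]
    _ = ∫⁻ x, (M' ⁻¹' A).indicator (fun y => ENNReal.ofReal (r' y)) (L x) ∂μE := by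
        refine lintegral_congr (fun x => ?_)
        rw [hpre]
        simp only [indicator, mem_preimage, hr', L.symm_apply_apply]
    _ = c * ∫⁻ y, (M' ⁻¹' A).indicator (fun y => ENNReal.ofReal (r' y)) y ∂(μY.prod Measure.addHaar) :=
        hcid _ (((ENNReal.measurable_ofReal.comp hr'm)).indicator (hM'm hA))
    _ = c * ((μY.prod (Measure.addHaar : Measure f'.ker)).withDensity fun y => ENNReal.ofReal (r' y)) (M' ⁻¹' A) := by
        rw [withDensity_apply _ (hM'm hA), lintegral_indicator (hM'm hA)]
    _ = c * ∫⁻ W in A, ENNReal.ofReal (I₀ W) ∂μY := by rw [hIdens A hA hAD]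
    _ = ∫⁻ W in A, ENNReal.ofReal ((c : ℝ) * I₀ W) ∂μY := by
        rw [← lintegral_const_mul' _ _ ENNReal.coe_ne_top]
        refine lintegral_congr (fun W => ?_)
        rw [ENNReal.ofReal_mul c.coe_nonneg, ENNReal.ofReal_coe_nnreal]

/-! ## §3 Corollaries: nowhere-fibre-flat thresholds (plain exemption), ambient-analytic thresholds without transversality -/

/-- ★★ **NOWHERE FIBRE-FLAT THRESHOLDS ⇒ THE PLAIN EXEMPTION `∀ i, Γ i (M x) x ≠ 0`.**  If on `O₀` no threshold vanishes identically along the fibre near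
any of its zeros (`Γ i (M x) x = 0 ⇒ ∃ᶠ x' → x` on `M⁻¹(M x)` with `Γ i (M x) x' ≠ 0` — implied by transversality; at an eigenvalue crossing implied by the open
projection of the fibre onto the variable the threshold depends on), the engine holds with the siblings' continuity clause, WITHOUT transversality.
[cite: EvansGariepy1992, §3.4.3 Thm 2 (C¹-submersion special case)] [cite: Mityagin2015, Proposition 1] -/
theorem exists_continuousOn_density_map_of_analytic_submersion_sharp_of_nowhereFibreFlat {ι : Type*} [Countable ι] (μE : Measure E)
    [μE.IsAddHaarMeasure] (μY : Measure Y) [μY.IsAddHaarMeasure] {M : E → Y} (hMm : Measurable M) {a : E} (hMan : AnalyticAt ℝ M a)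
    (hsurj : (fderiv ℝ M a).range = ⊤) {Γ : ι → Y → E → ℝ} {O₀ : Set E} (hO₀ : IsOpen O₀) (haO₀ : a ∈ O₀)
    (hΓan : ∀ i y, AnalyticOnNhd ℝ (Γ i y) O₀)
    (hnf : ∀ x ∈ O₀, ∀ i, Γ i (M x) x = 0 → ∃ᶠ x' in 𝓝[M ⁻¹' {M x}] x, Γ i (M x) x' ≠ 0) :
    ∃ O : Set E, IsOpen O ∧ a ∈ O ∧ O ⊆ O₀ ∧ ∃ D : Set Y, IsOpen D ∧ M a ∈ D ∧
      ∀ r : E → ℝ, Measurable r → (∀ x, 0 ≤ r x) → (∀ x ∈ O, (∀ i, Γ i (M x) x ≠ 0) → ContinuousAt r x) →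
        (∃ C, ∀ x ∈ O, r x ≤ C) → (∀ x, x ∉ O → r x = 0) →
        ∃ I : Y → ℝ, ContinuousOn I D ∧ (∀ W, 0 ≤ I W) ∧
          ∀ A : Set Y, MeasurableSet A → A ⊆ D →
            (μE.withDensity fun x => ENNReal.ofReal (r x)) (M ⁻¹' A) = ∫⁻ W in A, ENNReal.ofReal (I W) ∂μY := by
  obtain ⟨O, hOo, haO, hOO₀, D, hDo, haD, hH⟩ :=
    exists_continuousOn_density_map_of_analytic_submersion_sharp_fibreFlat μE μY hMm hMan hsurj hO₀ haO₀ hΓan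
  refine ⟨O, hOo, haO, hOO₀, D, hDo, haD, fun r hrm hr0 hrc hrb hrO => hH r hrm hr0 (fun x hx hex => hrc x hx fun i => ?_) hrb hrO⟩
  rcases hex i with h | h
  · exact h
  · intro h0
    obtain ⟨x', hx'ne, hx'eq⟩ := ((hnf x (hOO₀ hx) i h0).and_eventually h).exists
    exact hx'ne hx'eq

/-- ★ **AMBIENT-ANALYTIC THRESHOLDS WITHOUT TRANSVERSALITY** (the siblings' setting minus (β)): `g i : E → ℝ` real-analytic on `O₀ ∋ a`; the density must be
continuous at the points of `O` where every `g i` is non-zero OR vanishes near the point along the fibre.  (The main theorem at `Γ i y := g i`.)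
[cite: EvansGariepy1992, §3.4.3 Thm 2 (C¹-submersion special case)] [cite: Mityagin2015, Proposition 1] -/
theorem exists_continuousOn_density_map_of_analytic_submersion_sharp_ambient_fibreFlat {ι : Type*} [Countable ι] (μE : Measure E)
    [μE.IsAddHaarMeasure] (μY : Measure Y) [μY.IsAddHaarMeasure] {M : E → Y} (hMm : Measurable M) {a : E} (hMan : AnalyticAt ℝ M a)
    (hsurj : (fderiv ℝ M a).range = ⊤) {g : ι → E → ℝ} {O₀ : Set E} (hO₀ : IsOpen O₀) (haO₀ : a ∈ O₀)
    (hgan : ∀ i, AnalyticOnNhd ℝ (g i) O₀) :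
    ∃ O : Set E, IsOpen O ∧ a ∈ O ∧ O ⊆ O₀ ∧ ∃ D : Set Y, IsOpen D ∧ M a ∈ D ∧
      ∀ r : E → ℝ, Measurable r → (∀ x, 0 ≤ r x) →
        (∀ x ∈ O, (∀ i, g i x ≠ 0 ∨ ∀ᶠ x' in 𝓝[M ⁻¹' {M x}] x, g i x' = 0) → ContinuousAt r x) →
        (∃ C, ∀ x ∈ O, r x ≤ C) → (∀ x, x ∉ O → r x = 0) →
        ∃ I : Y → ℝ, ContinuousOn I D ∧ (∀ W, 0 ≤ I W) ∧
          ∀ A : Set Y, MeasurableSet A → A ⊆ D →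
            (μE.withDensity fun x => ENNReal.ofReal (r x)) (M ⁻¹' A) = ∫⁻ W in A, ENNReal.ofReal (I W) ∂μY :=
  exists_continuousOn_density_map_of_analytic_submersion_sharp_fibreFlat μE μY hMm hMan hsurj hO₀ haO₀
    (Γ := fun i _ => g i) (fun i _ => hgan i)

end Literature.MeasureTheory.Integral.AnalyticSubmersion

end
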